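import Mathlib
import Summits.ValiantsHypothesis.ValiantsHypothesis.Theorems.ElementaryWordLengthWordLengthQPStubInversionCost

/-!
# Crux `WordLengthQP` (stmt-ValiantsHypothesis-6623), line `positive-monoid-exits` —
THEOREM M₃ for FORMS: every product of three nonnegative affine-linear forms has ≤ 25 exits (lead c6)

General form of `…TripleProductExits`: a nonnegative affine-linear form is given as a list `L` of
`(c, o) : ℝ × Option σ` with `c > 0`, read as `Σ c · (x_o or 1)`; its letter BLOCK in the root group
`(i, j)` is the list of letters `(i, j, c, o)`, a product of POSITIVE letters equal to `E_ij(form)`.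
For three such forms `p, q, r` the palindromic sandwich
`x₁(r) x₂(1) y₁(q) x₁(p) y₁(q) x₁(r) x₂(1) = (x₂(1) x₁(r) y₁(q)) · E₀₂(p q r + 2 r) · (x₁(p) x₂(1) y₁(q) x₁(r))`
(`tripleForm_sandwich`, any commutative ring) is a `b = 3` certificate for `E₀₂(pqr + 2r)`; the junk is
removed by `E₀₂(-2r) = x₁(-2) x₂(r) x₁(2) x₂(r)⁻¹` (one exit plus an 8-exit inversion), and the two
inversions `Q₁⁻¹, Q₂⁻¹` cost 8 exits each (`stub_inversionCost`): `8 + 0 + 8 + 9 = 25` exits for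
`E₀₂(p q r)` (registered calibration stub `stub_tripleFormExits`).  In particular every Ryser product
`∏_{i≤3} (Σ_{j∈S} x_ij)` and every triple product of variables; the constant `25` does not depend on `σ`
or on the supports.  No definitions. [folklore]
-/

-- `Summit.ValiantsHypothesis.ValiantsHypothesis.…` is the tree's mandated single-conjunct layout
-- (Sub = Summit), so the duplicated namespace component is intended.
set_option linter.dupNamespace false

noncomputable section

namespace Summit.ValiantsHypothesis.ValiantsHypothesis.Cruxes.WordLengthQP.PositiveMonoidExits

open Matrix

/-- **The palindromic sandwich over any commutative ring**:
`x₁(r) x₂(1) y₁(q) x₁(p) y₁(q) x₁(r) x₂(1) = (x₂(1) x₁(r) y₁(q)) · E₀₂(pqr + 2r) · (x₁(p) x₂(1) y₁(q) x₁(r))`. [folklore] -/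
theorem tripleForm_sandwich {R : Type*} [CommRing R] (p q r : R) :
    Matrix.transvection (0 : Fin 3) 1 r * (Matrix.transvection (1 : Fin 3) 2 (1 : R) *
      (Matrix.transvection (1 : Fin 3) 0 q * (Matrix.transvection (0 : Fin 3) 1 p *
      (Matrix.transvection (1 : Fin 3) 0 q * (Matrix.transvection (0 : Fin 3) 1 r *
      Matrix.transvection (1 : Fin 3) 2 (1 : R)))))) =
    (Matrix.transvection (1 : Fin 3) 2 (1 : R) * (Matrix.transvection (0 : Fin 3) 1 r *
      Matrix.transvection (1 : Fin 3) 0 q)) *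
    Matrix.transvection (0 : Fin 3) 2 (p * q * r + 2 * r) *
    (Matrix.transvection (0 : Fin 3) 1 p * (Matrix.transvection (1 : Fin 3) 2 (1 : R) *
      (Matrix.transvection (1 : Fin 3) 0 q * Matrix.transvection (0 : Fin 3) 1 r))) := by
  apply Matrix.ext
  intro i j
  fin_cases i <;> fin_cases j <;>
    simp [Matrix.transvection, Matrix.mul_apply, Fin.sum_univ_three, Matrix.single, Matrix.of_apply,
      Matrix.one_apply] <;> ring

/-- `x₁(a) x₂(b) x₁(-a) = E₀₂(ab) x₂(b)` (the Heisenberg commutator, half of `[x₁(a), x₂(b)] = E₀₂(ab)`). [folklore] -/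
theorem tripleForm_heisenberg {R : Type*} [CommRing R] (a b : R) :
    Matrix.transvection (0 : Fin 3) 1 a * (Matrix.transvection (1 : Fin 3) 2 b *
      Matrix.transvection (0 : Fin 3) 1 (-a)) =
    Matrix.transvection (0 : Fin 3) 2 (a * b) * Matrix.transvection (1 : Fin 3) 2 b := by
  apply Matrix.ext
  intro i j
  fin_cases i <;> fin_cases j <;>
    simp [Matrix.transvection, Matrix.mul_apply, Fin.sum_univ_three, Matrix.single, Matrix.of_apply,
      Matrix.one_apply]

/-- **Block lemma**: the letters `(i, j, c, o)` of a list `L` multiply to `E_ij(Σ c · (x_o or 1))`. [folklore] -/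
theorem tripleForm_block {σ : Type} (i j : Fin 3) (hij : i ≠ j) (L : List (ℝ × Option σ)) :
    ((L.map (fun p : ℝ × Option σ => ((i, j, p.1, p.2) : Fin 3 × Fin 3 × ℝ × Option σ))).map
      (fun l => Matrix.transvection l.1 l.2.1
        (MvPolynomial.C l.2.2.1 * l.2.2.2.elim 1 MvPolynomial.X))).prod =
      Matrix.transvection i j
        ((L.map (fun p : ℝ × Option σ => MvPolynomial.C p.1 * p.2.elim 1 MvPolynomial.X)).sum :
          MvPolynomial σ ℝ) := by
  induction L with
  | nil => simp
  | cons p L ih =>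
    simp only [List.map_cons, List.prod_cons, List.sum_cons]
    rw [ih, Matrix.transvection_mul_transvection_same _ _ hij]

/-- Letters of a block are valid and, when the coefficients are positive and `|i - j| = 1`, positive
adjacent. [folklore] -/
theorem tripleForm_block_mem {σ : Type} (i j : Fin 3) (L : List (ℝ × Option σ))
    (l : Fin 3 × Fin 3 × ℝ × Option σ)
    (hl : l ∈ L.map (fun p : ℝ × Option σ => ((i, j, p.1, p.2) : Fin 3 × Fin 3 × ℝ × Option σ))) :
    ∃ p ∈ L, l = (i, j, p.1, p.2) := by
  obtain ⟨p, hp, rfl⟩ := List.mem_map.mp hl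
  exact ⟨p, hp, rfl⟩

/-- **THEOREM M₃ for forms (registered calibration stub `stub_tripleFormExits`, lead c6).**  For any three
nonnegative affine-linear forms `p, q, r` (lists of `(c, o)` with `c > 0`, value `Σ c · (x_o or 1)`) the
transvection `E₀₂(p q r)` has a valid real word with at most `25` exits:
`Q₁⁻¹ · R · Q₂⁻¹ · x₁(-2) x₂(r) x₁(2) x₂(r)⁻¹` with the palindromic sandwich `R = Q₁ E₀₂(pqr + 2r) Q₂`
(`tripleForm_sandwich`) and 8-exit inversions (`stub_inversionCost`). [folklore] -/
theorem stub_tripleFormExits {σ : Type} (L₁ L₂ L₃ : List (ℝ × Option σ))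
    (h₁ : ∀ p ∈ L₁, 0 < p.1) (h₂ : ∀ p ∈ L₂, 0 < p.1) (h₃ : ∀ p ∈ L₃, 0 < p.1) :
    ∃ w : List (Fin 3 × Fin 3 × ℝ × Option σ), (∀ l ∈ w, l.1 ≠ l.2.1) ∧
      (w.map (fun l => Matrix.transvection l.1 l.2.1
        (MvPolynomial.C l.2.2.1 * l.2.2.2.elim 1 MvPolynomial.X))).prod =
        Matrix.transvection (0 : Fin 3) 2
          (((L₁.map (fun p : ℝ × Option σ => MvPolynomial.C p.1 * p.2.elim 1 MvPolynomial.X)).sum :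
              MvPolynomial σ ℝ) *
            (L₂.map (fun p : ℝ × Option σ => MvPolynomial.C p.1 * p.2.elim 1 MvPolynomial.X)).sum *
            (L₃.map (fun p : ℝ × Option σ => MvPolynomial.C p.1 * p.2.elim 1 MvPolynomial.X)).sum) ∧
      (w.filter (fun l => !decide (0 < l.2.2.1 ∧
          (l.1.val + 1 = l.2.1.val ∨ l.2.1.val + 1 = l.1.val)))).length ≤ 25 := by
  -- names for the three values and the blocks
  set p : MvPolynomial σ ℝ :=
    (L₁.map (fun p : ℝ × Option σ => MvPolynomial.C p.1 * p.2.elim 1 MvPolynomial.X)).sum with hp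
  set q : MvPolynomial σ ℝ :=
    (L₂.map (fun p : ℝ × Option σ => MvPolynomial.C p.1 * p.2.elim 1 MvPolynomial.X)).sum with hq
  set r : MvPolynomial σ ℝ :=
    (L₃.map (fun p : ℝ × Option σ => MvPolynomial.C p.1 * p.2.elim 1 MvPolynomial.X)).sum with hr
  set Bp : List (Fin 3 × Fin 3 × ℝ × Option σ) :=
    L₁.map (fun p : ℝ × Option σ => (((0 : Fin 3), (1 : Fin 3), p.1, p.2) : Fin 3 × Fin 3 × ℝ × Option σ))
    with hBp
  set Bq : List (Fin 3 × Fin 3 × ℝ × Option σ) :=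
    L₂.map (fun p : ℝ × Option σ => (((1 : Fin 3), (0 : Fin 3), p.1, p.2) : Fin 3 × Fin 3 × ℝ × Option σ))
    with hBq
  set Br : List (Fin 3 × Fin 3 × ℝ × Option σ) :=
    L₃.map (fun p : ℝ × Option σ => (((0 : Fin 3), (1 : Fin 3), p.1, p.2) : Fin 3 × Fin 3 × ℝ × Option σ))
    with hBr
  set Br2 : List (Fin 3 × Fin 3 × ℝ × Option σ) :=
    L₃.map (fun p : ℝ × Option σ => (((1 : Fin 3), (2 : Fin 3), p.1, p.2) : Fin 3 × Fin 3 × ℝ × Option σ))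
    with hBr2
  have hBp_prod := tripleForm_block (σ := σ) 0 1 (by decide) L₁
  have hBq_prod := tripleForm_block (σ := σ) 1 0 (by decide) L₂
  have hBr_prod := tripleForm_block (σ := σ) 0 1 (by decide) L₃
  have hBr2_prod := tripleForm_block (σ := σ) 1 2 (by decide) L₃
  rw [← hBp, ← hp] at hBp_prod
  rw [← hBq, ← hq] at hBq_prod
  rw [← hBr, ← hr] at hBr_prod
  rw [← hBr2, ← hr] at hBr2_prod
  -- positivity / adjacency of block letters
  have posBp : ∀ l ∈ Bp, 0 < l.2.2.1 ∧ (l.1.val + 1 = l.2.1.val ∨ l.2.1.val + 1 = l.1.val) := by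
    intro l hl
    obtain ⟨a, ha, rfl⟩ := tripleForm_block_mem 0 1 L₁ l hl
    exact ⟨h₁ a ha, by simp⟩
  have posBq : ∀ l ∈ Bq, 0 < l.2.2.1 ∧ (l.1.val + 1 = l.2.1.val ∨ l.2.1.val + 1 = l.1.val) := by
    intro l hl
    obtain ⟨a, ha, rfl⟩ := tripleForm_block_mem 1 0 L₂ l hl
    exact ⟨h₂ a ha, by simp⟩
  have posBr : ∀ l ∈ Br, 0 < l.2.2.1 ∧ (l.1.val + 1 = l.2.1.val ∨ l.2.1.val + 1 = l.1.val) := by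
    intro l hl
    obtain ⟨a, ha, rfl⟩ := tripleForm_block_mem 0 1 L₃ l hl
    exact ⟨h₃ a ha, by simp⟩
  have posBr2 : ∀ l ∈ Br2, 0 < l.2.2.1 ∧ (l.1.val + 1 = l.2.1.val ∨ l.2.1.val + 1 = l.1.val) := by
    intro l hl
    obtain ⟨a, ha, rfl⟩ := tripleForm_block_mem 1 2 L₃ l hl
    exact ⟨h₃ a ha, by simp⟩
  have posX2 : ∀ l ∈ [(((1 : Fin 3), (2 : Fin 3), (1 : ℝ), (none : Option σ)) : Fin 3 × Fin 3 × ℝ × Option σ)],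
      0 < l.2.2.1 ∧ (l.1.val + 1 = l.2.1.val ∨ l.2.1.val + 1 = l.1.val) := by
    intro l hl
    simp only [List.mem_singleton] at hl
    subst hl
    norm_num
  have hv : ∀ (w : List (Fin 3 × Fin 3 × ℝ × Option σ)),
      (∀ l ∈ w, 0 < l.2.2.1 ∧ (l.1.val + 1 = l.2.1.val ∨ l.2.1.val + 1 = l.1.val)) →
      ∀ l ∈ w, l.1 ≠ l.2.1 := by
    intro w hw l hl he
    have h2 := (hw l hl).2
    rw [he] at h2
    omega
  have posApp : ∀ (u v : List (Fin 3 × Fin 3 × ℝ × Option σ)),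
      (∀ l ∈ u, 0 < l.2.2.1 ∧ (l.1.val + 1 = l.2.1.val ∨ l.2.1.val + 1 = l.1.val)) →
      (∀ l ∈ v, 0 < l.2.2.1 ∧ (l.1.val + 1 = l.2.1.val ∨ l.2.1.val + 1 = l.1.val)) →
      ∀ l ∈ u ++ v, 0 < l.2.2.1 ∧ (l.1.val + 1 = l.2.1.val ∨ l.2.1.val + 1 = l.1.val) := by
    intro u v hu hv' l hl
    rcases List.mem_append.mp hl with hl | hl
    · exact hu l hl
    · exact hv' l hl
  have filter_nil : ∀ (w : List (Fin 3 × Fin 3 × ℝ × Option σ)),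
      (∀ l ∈ w, 0 < l.2.2.1 ∧ (l.1.val + 1 = l.2.1.val ∨ l.2.1.val + 1 = l.1.val)) →
      (w.filter (fun l => !decide (0 < l.2.2.1 ∧
        (l.1.val + 1 = l.2.1.val ∨ l.2.1.val + 1 = l.1.val)))).length = 0 := by
    intro w hw
    rw [List.length_eq_zero_iff, List.filter_eq_nil_iff]
    intro l hl
    have h := hw l hl
    simp [h]
  -- the three positive words
  set Q₁ : List (Fin 3 × Fin 3 × ℝ × Option σ) :=
    [(((1 : Fin 3), (2 : Fin 3), (1 : ℝ), (none : Option σ)) : Fin 3 × Fin 3 × ℝ × Option σ)] ++ Br ++ Bq with hQ₁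
  set Rw : List (Fin 3 × Fin 3 × ℝ × Option σ) :=
    Br ++ [(((1 : Fin 3), (2 : Fin 3), (1 : ℝ), (none : Option σ)) : Fin 3 × Fin 3 × ℝ × Option σ)] ++ Bq ++
      Bp ++ Bq ++ Br ++
      [(((1 : Fin 3), (2 : Fin 3), (1 : ℝ), (none : Option σ)) : Fin 3 × Fin 3 × ℝ × Option σ)] with hRw
  set Q₂ : List (Fin 3 × Fin 3 × ℝ × Option σ) :=
    Bp ++ [(((1 : Fin 3), (2 : Fin 3), (1 : ℝ), (none : Option σ)) : Fin 3 × Fin 3 × ℝ × Option σ)] ++ Bq ++ Br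
    with hQ₂
  have posQ₁ : ∀ l ∈ Q₁, 0 < l.2.2.1 ∧ (l.1.val + 1 = l.2.1.val ∨ l.2.1.val + 1 = l.1.val) :=
    posApp _ _ (posApp _ _ posX2 posBr) posBq
  have posRw : ∀ l ∈ Rw, 0 < l.2.2.1 ∧ (l.1.val + 1 = l.2.1.val ∨ l.2.1.val + 1 = l.1.val) :=
    posApp _ _ (posApp _ _ (posApp _ _ (posApp _ _ (posApp _ _ (posApp _ _ posBr posX2) posBq) posBp)
      posBq) posBr) posX2
  have posQ₂ : ∀ l ∈ Q₂, 0 < l.2.2.1 ∧ (l.1.val + 1 = l.2.1.val ∨ l.2.1.val + 1 = l.1.val) :=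
    posApp _ _ (posApp _ _ (posApp _ _ posBp posX2) posBq) posBr
  obtain ⟨Q₁', hv1', hinv1, hex1, -⟩ := stub_inversionCost Q₁ (hv Q₁ posQ₁)
  obtain ⟨Q₂', hv2', hinv2, hex2, -⟩ := stub_inversionCost Q₂ (hv Q₂ posQ₂)
  obtain ⟨Br2', hv3', hinv3, hex3, -⟩ := stub_inversionCost Br2 (hv Br2 posBr2)
  have hinv2' := mul_eq_one_comm.mp hinv2
  have hinv3' := mul_eq_one_comm.mp hinv3
  -- values of the words
  have hx2 : (List.map (fun l => Matrix.transvection l.1 l.2.1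
      (MvPolynomial.C l.2.2.1 * l.2.2.2.elim 1 MvPolynomial.X))
      [(((1 : Fin 3), (2 : Fin 3), (1 : ℝ), (none : Option σ)) : Fin 3 × Fin 3 × ℝ × Option σ)]).prod =
      Matrix.transvection (1 : Fin 3) 2 (1 : MvPolynomial σ ℝ) := by simp
  have hQ₁v : (Q₁.map (fun l => Matrix.transvection l.1 l.2.1
      (MvPolynomial.C l.2.2.1 * l.2.2.2.elim 1 MvPolynomial.X))).prod =
      Matrix.transvection (1 : Fin 3) 2 (1 : MvPolynomial σ ℝ) *
        (Matrix.transvection (0 : Fin 3) 1 r * Matrix.transvection (1 : Fin 3) 0 q) := by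
    rw [hQ₁, List.map_append, List.map_append, List.prod_append, List.prod_append, hx2, hBr_prod, hBq_prod,
      mul_assoc]
  have hRv : (Rw.map (fun l => Matrix.transvection l.1 l.2.1
      (MvPolynomial.C l.2.2.1 * l.2.2.2.elim 1 MvPolynomial.X))).prod =
      Matrix.transvection (0 : Fin 3) 1 r * (Matrix.transvection (1 : Fin 3) 2 (1 : MvPolynomial σ ℝ) *
      (Matrix.transvection (1 : Fin 3) 0 q * (Matrix.transvection (0 : Fin 3) 1 p *
      (Matrix.transvection (1 : Fin 3) 0 q * (Matrix.transvection (0 : Fin 3) 1 r *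
      Matrix.transvection (1 : Fin 3) 2 (1 : MvPolynomial σ ℝ)))))) := by
    rw [hRw]
    simp only [List.map_append, List.prod_append, hx2, hBr_prod, hBq_prod, hBp_prod, mul_assoc]
  have hQ₂v : (Q₂.map (fun l => Matrix.transvection l.1 l.2.1
      (MvPolynomial.C l.2.2.1 * l.2.2.2.elim 1 MvPolynomial.X))).prod =
      Matrix.transvection (0 : Fin 3) 1 p * (Matrix.transvection (1 : Fin 3) 2 (1 : MvPolynomial σ ℝ) *
      (Matrix.transvection (1 : Fin 3) 0 q * Matrix.transvection (0 : Fin 3) 1 r)) := by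
    rw [hQ₂]
    simp only [List.map_append, List.prod_append, hx2, hBr_prod, hBq_prod, hBp_prod, mul_assoc]
  have hsand : (Rw.map (fun l => Matrix.transvection l.1 l.2.1
      (MvPolynomial.C l.2.2.1 * l.2.2.2.elim 1 MvPolynomial.X))).prod =
      (Q₁.map (fun l => Matrix.transvection l.1 l.2.1
        (MvPolynomial.C l.2.2.1 * l.2.2.2.elim 1 MvPolynomial.X))).prod *
      Matrix.transvection (0 : Fin 3) 2 (p * q * r + 2 * r) *
      (Q₂.map (fun l => Matrix.transvection l.1 l.2.1
        (MvPolynomial.C l.2.2.1 * l.2.2.2.elim 1 MvPolynomial.X))).prod := by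
    rw [hRv, hQ₁v, hQ₂v]
    exact tripleForm_sandwich p q r
  -- the junk word
  set J : List (Fin 3 × Fin 3 × ℝ × Option σ) :=
    [(((0 : Fin 3), (1 : Fin 3), (-2 : ℝ), (none : Option σ)) : Fin 3 × Fin 3 × ℝ × Option σ)] ++ Br2 ++
    [(((0 : Fin 3), (1 : Fin 3), (2 : ℝ), (none : Option σ)) : Fin 3 × Fin 3 × ℝ × Option σ)] ++ Br2' with hJ
  have hJv : (J.map (fun l => Matrix.transvection l.1 l.2.1
      (MvPolynomial.C l.2.2.1 * l.2.2.2.elim 1 MvPolynomial.X))).prod =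
      Matrix.transvection (0 : Fin 3) 2 (-2 * r) := by
    rw [hJ]
    simp only [List.map_append, List.map_cons, List.map_nil, List.prod_append, List.prod_cons, List.prod_nil,
      mul_one, Option.elim_none, map_neg, map_ofNat, hBr2_prod]
    calc Matrix.transvection (0 : Fin 3) 1 (-2) * Matrix.transvection (1 : Fin 3) 2 r *
          Matrix.transvection (0 : Fin 3) 1 2 *
          (List.map (fun l => Matrix.transvection l.1 l.2.1
            (MvPolynomial.C l.2.2.1 * l.2.2.2.elim 1 MvPolynomial.X)) Br2').prod
        = (Matrix.transvection (0 : Fin 3) 1 (-2) * (Matrix.transvection (1 : Fin 3) 2 r *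
            Matrix.transvection (0 : Fin 3) 1 (-(-2)))) *
          (List.map (fun l => Matrix.transvection l.1 l.2.1
            (MvPolynomial.C l.2.2.1 * l.2.2.2.elim 1 MvPolynomial.X)) Br2').prod := by
          rw [neg_neg]; simp only [mul_assoc]
      _ = Matrix.transvection (0 : Fin 3) 2 (-2 * r) := by
          rw [tripleForm_heisenberg, mul_assoc, ← hBr2_prod, hinv3', mul_one]
  have posJexits : (J.filter (fun l => !decide (0 < l.2.2.1 ∧
      (l.1.val + 1 = l.2.1.val ∨ l.2.1.val + 1 = l.1.val)))).length ≤ 9 := by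
    rw [hJ, List.filter_append, List.filter_append, List.filter_append, List.length_append,
      List.length_append, List.length_append, filter_nil Br2 posBr2]
    have e3 := filter_nil Br2 posBr2
    simp only [e3] at hex3
    have a1 : (List.filter (fun l => !decide (0 < l.2.2.1 ∧
        (l.1.val + 1 = l.2.1.val ∨ l.2.1.val + 1 = l.1.val)))
        [(((0 : Fin 3), (1 : Fin 3), (-2 : ℝ), (none : Option σ)) : Fin 3 × Fin 3 × ℝ × Option σ)]).length = 1 := by
      norm_num [List.filter_cons]
    have a2 : (List.filter (fun l => !decide (0 < l.2.2.1 ∧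
        (l.1.val + 1 = l.2.1.val ∨ l.2.1.val + 1 = l.1.val)))
        [(((0 : Fin 3), (1 : Fin 3), (2 : ℝ), (none : Option σ)) : Fin 3 × Fin 3 × ℝ × Option σ)]).length = 0 := by
      norm_num [List.filter_cons]
    rw [a1, a2]
    omega
  -- assemble
  refine ⟨Q₁' ++ Rw ++ Q₂' ++ J, ?_, ?_, ?_⟩
  · intro l hl
    simp only [List.mem_append] at hl
    rcases hl with ((hl | hl) | hl) | hl
    · exact hv1' l hl
    · exact hv Rw posRw l hl
    · exact hv2' l hl
    · rw [hJ] at hl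
      simp only [List.mem_append, List.mem_singleton] at hl
      rcases hl with ((hl | hl) | hl) | hl
      · subst hl; exact (by decide : (0 : Fin 3) ≠ 1)
      · exact hv Br2 posBr2 l hl
      · subst hl; exact (by decide : (0 : Fin 3) ≠ 1)
      · exact hv3' l hl
  · rw [List.map_append, List.map_append, List.map_append, List.prod_append, List.prod_append,
      List.prod_append, hsand, hJv]
    have key : ∀ (A A' B B' : Matrix (Fin 3) (Fin 3) (MvPolynomial σ ℝ)) (F G : MvPolynomial σ ℝ),
        A' * A = 1 → B * B' = 1 →
        A' * (A * Matrix.transvection (0 : Fin 3) 2 F * B) * B' * Matrix.transvection (0 : Fin 3) 2 G =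
          Matrix.transvection (0 : Fin 3) 2 (F + G) := by
      intro A A' B B' F G hA hB
      calc A' * (A * Matrix.transvection (0 : Fin 3) 2 F * B) * B' * Matrix.transvection (0 : Fin 3) 2 G
          = (A' * A) * Matrix.transvection (0 : Fin 3) 2 F * (B * B') * Matrix.transvection (0 : Fin 3) 2 G := by
            simp only [mul_assoc]
        _ = Matrix.transvection (0 : Fin 3) 2 (F + G) := by
            rw [hA, hB, one_mul, mul_one, Matrix.transvection_mul_transvection_same _ _ (by decide)]
    rw [key _ _ _ _ _ _ hinv1 hinv2']
    congr 1
    ring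
  · rw [List.filter_append, List.filter_append, List.filter_append, List.length_append,
      List.length_append, List.length_append, filter_nil Rw posRw]
    have e1 := filter_nil Q₁ posQ₁
    have e2 := filter_nil Q₂ posQ₂
    simp only [e1] at hex1
    simp only [e2] at hex2
    omega

end Summit.ValiantsHypothesis.ValiantsHypothesis.Cruxes.WordLengthQP.PositiveMonoidExits

end
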